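import Mathlib.Analysis.SpecialFunctions.Log.Base
import Mathlib.Analysis.SpecialFunctions.Pow.Real
import Mathlib.Analysis.SpecialFunctions.Sqrt
import Mathlib.Analysis.Complex.ExponentialBounds
import Literature.Computability.QuantumComplexity.ProofOfQuantumnessEATRate

/-!
# Entropy accumulation in Rényi form: the printed closed forms of Dupuis–Fawzi (Thm 5.2) and of the
generalised EAT (Metger–Fawzi–Sutter–Renner Thm 4.3), and their two-sided finite-size threshold

Topic `Literature/Computability/QuantumComplexity` (cell qa-cr, line L-14 `renyi-eat-testing-lift`;
companion of `ProofOfQuantumnessEATRate.lean`, which types the EAT closed form `n t − μ √n` of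
[MerkulovArnonFriedman2023] Thm 18 ("EAT-v1" below) that §4 compares against).

HONEST FRAMING: this file types ONLY PRINTED CLOSED-FORM REAL FUNCTIONS — the right-hand sides of
two published min-entropy lower bounds — plus elementary real arithmetic about them (when the
printed expression is `≤ 0`, when it is `≥ nh/4`, how the two papers' expressions compare). The
entropy INEQUALITIES themselves (smooth min-entropy of a sequence of channels' outputs conditioned
on an event) are NOT typed: they need the cq state as a Lean object. No `def … : Prop` fact is
minted; every range restriction of the sources is an explicit hypothesis; nothing here bears on any
protocol's soundness or on BQP vs BPP.

## Sources, verbatim (TeX of the arXiv versions; `pNN Lk` = page/line of the materialised text)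

* F. Dupuis, O. Fawzi, *Entropy accumulation with improved second-order term*, IEEE Trans. Inf.
  Theory **65** (2019) 7596, arXiv:1805.11652 [DupuisFawzi2018] ("DF19").
  **Thm 5.2, eq. (eat-min-alpha) as displayed** (p13 L83), for `α ∈ (1,2)` (p14 L16):
  `H^ε_min(A₁ⁿ|B₁ⁿE)_{ρ|Ω} ≥ n h − n ((α−1) ln2 / 2) V² − (1/(α−1)) log(2/(ε² ρ[Ω]²))
  − n (α−1)² K_α`, with (p13 L86–91) `V = √(Var f + 2) + log(2 d_A² + 1)`,
  `K_α = (6 (2−α)³ ln 2)⁻¹ · 2^{(α−1)(2 log d_A + Max f − Min_Σ f)} ln³(2^{2 log d_A + Max f −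
  Min_Σ f} + e²)`.  **Proof of Thm 5.2, first line** (p16 L20), same range:
  `… > n h − n ((α−1) ln2 / 2) V² − (α/(α−1)) log(1/ρ[Ω]) − n (α−1)² K_α − log(2/ε²)/(α−1)`;
  second line (p16 L21–24): for `α ≤ 1 + 1/(2 ln 2)` the α-free
  `K = 12 · 2^{2 log d_A + Max f − Min_Σ f} ln³(2^{…} + e²)` replaces `K_α`; the schedule
  `α − 1 = √(2 log(2/(ε²ρ[Ω]²)) / (n ln 2)) / V` "to make the terms in α−1 and 1/(α−1) match" (p16).
* T. Metger, O. Fawzi, D. Sutter, R. Renner, *Generalised entropy accumulation*, FOCS 2022 /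
  Commun. Math. Phys. **405** (2024), arXiv:2203.04989 [MetgerEtAl2022] ("MFSR22").
  **Thm 4.3** (p17 L26–43), channels with the non-signalling condition, `ε ∈ (0,1)`,
  `α ∈ (1, 3/2)`, affine `f`:  `H^ε_min(Aⁿ|E_n)_{…|Ω} ≥ n h − n ((α−1)/(2−α)) (ln2/2) V²
  − (g(ε) + α log(1/Pr[Ω]))/(α−1) − n ((α−1)/(2−α))² K'(α)`, `g(ε) = −log(1 − √(1−ε²))`,
  `V = log(2d_A²+1) + √(2 + Var f)`.

Conventions: `log` of both sources is `log₂`; the Rényi step is `s = α − 1`; the merged confidence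
term of the displayed DF19 bound is `L = log₂(2/(ε² ρ[Ω]²)) = 1 − 2 log₂(ε·ρ[Ω])` (`Lval`) — the
SAME quantity that sits under the square root of EAT-v1's coefficient
`ProofOfQuantumnessEATRate.mu` ([MerkulovArnonFriedman2023] eq. (14)), see `two_grad_sqrt_le_mu`.

## What is here (definitions + elementary lemmas; 0 named facts, 0 sorries)

§1 `renyiBound` (DF19 displayed right-hand side as a function of `s`), `Lval`,
`N0v2 := 2 ln2 V² L/h²`, `sOpt` (DF19's schedule), `Kalpha`; `renyiBound_nonpos_of_le_N0v2` (for
EVERY `s > 0`, `K ≥ 0` the displayed bound is `≤ 0` whenever `n ≤ N0v2` — AM–GM in `s`),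
`sOpt_at_N0v2` and `renyiBound_eq_zero_at_N0v2` (the floor is ATTAINED: with `K = 0` the bound
vanishes at `n = N0v2` along the schedule);
`renyiBoundA` (the proof's sharper first line), `renyiBoundA_eq`, `renyiBound_le_renyiBoundA`
(DF19's merge, `α ≤ 2`), `renyiBoundA_nonpos`.  §2 `renyiBound_sOpt_ge` (at the schedule the
displayed bound is `≥ nh/4` once `n ≥ 4·N0v2` and `n ≥ 8LK/(ln2 V² h)`; constants sufficient, not
sharp), `sOpt_le_printed` (under `h ≤ V²` the schedule has `α ≤ 1 + 1/(2 ln 2)`, DF19's α-free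
`K`-range), `Kalpha_mono`.  §3 `geatBound` (MFSR22 Thm 4.3 right-hand side),
`geatBound_le_renyiBound`, `geatBound_nonpos_of_le_N0v2` (on `α ∈ (1,3/2)`).  §4 dictionary to
EAT-v1: `one_le_Lval`, `headline_sq_eq_N0v2`, `two_grad_sqrt_le_mu` (`2·grad·√L ≤ μ`).
-/

namespace Literature.Computability.QuantumComplexity.RenyiEATRate

open Literature.Computability.QuantumComplexity.ProofOfQuantumnessEATRate

/-! ## §1 DF19 Thm 5.2: the Rényi-form bound and its α-uniform floor -/

/-- DF19 Thm 5.2 eq. (eat-min-alpha) AS DISPLAYED (p13; merged confidence term `L`), as a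
function of the Rényi step `s = α − 1`: `n h − n s (ln2/2) V² − L/s − n s² K` (`K ≥ K_α`).
[cite: DupuisFawzi2018, Thm 5.2 eq. (eat-min-alpha)] -/
noncomputable def renyiBound (n h V L K s : ℝ) : ℝ :=
  n * h - n * s * (Real.log 2 / 2) * V ^ 2 - L / s - n * s ^ 2 * K

/-- The merged confidence term `L = 1 − 2 log₂(ε·ρ[Ω]) = log₂(2/(ε² ρ[Ω]²))` of the displayed
bound. [cite: DupuisFawzi2018, Thm 5.2 eq. (eat-min-alpha)] -/
noncomputable def Lval (εs pΩ : ℝ) : ℝ := 1 - 2 * Real.logb 2 (εs * pΩ)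

/-- The threshold `N₀⁽²⁾ = 2 ln2 · V² · L / h²` below which the displayed bound is `≤ 0`
(`renyiBound_nonpos_of_le_N0v2`). Arithmetic on [cite: DupuisFawzi2018, Thm 5.2]. -/
noncomputable def N0v2 (h V L : ℝ) : ℝ := 2 * Real.log 2 * V ^ 2 * L / h ^ 2

/-- DF19's schedule `α − 1 = √(2L/(n ln 2))/V` (p16, proof of Thm 5.2).
[cite: DupuisFawzi2018, Thm 5.2 proof] -/
noncomputable def sOpt (n V L : ℝ) : ℝ := Real.sqrt (2 * L / (n * Real.log 2)) / V

/-- DF19's constant `K_α = (6(2−α)³ ln2)⁻¹ · 2^{(α−1)E} · ln³(2^E + e²)`,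
`E = 2 log₂ d_A + Max f − Min_Σ f` (p13 L91). [cite: DupuisFawzi2018, Thm 5.2 eq. (Kalpha)] -/
noncomputable def Kalpha (α E : ℝ) : ℝ :=
  1 / (6 * (2 - α) ^ 3 * Real.log 2) * (2 : ℝ) ^ ((α - 1) * E)
    * Real.log ((2 : ℝ) ^ E + Real.exp 2) ^ 3

/-- **α-uniform floor.** For every Rényi step `s > 0` (⊇ the printed `α ∈ (1,2)`) and every
`K ≥ 0`, the displayed bound is `≤ 0` whenever `n ≤ N0v2 = 2 ln2 V² L/h²`
(AM–GM: `n s (ln2/2) V² + L/s ≥ V √(2 ln2 L n)`). Arithmetic on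
[cite: DupuisFawzi2018, Thm 5.2 eq. (eat-min-alpha)]. -/
theorem renyiBound_nonpos_of_le_N0v2 {n h V L K s : ℝ} (hs : 0 < s) (hK : 0 ≤ K) (hn : 0 ≤ n)
    (hh : 0 < h) (hL : 0 < L) (hle : n ≤ N0v2 h V L) : renyiBound n h V L K s ≤ 0 := by
  unfold renyiBound; unfold N0v2 at hle
  have h1 : n * h ^ 2 ≤ 2 * Real.log 2 * V ^ 2 * L := by rwa [le_div_iff₀ (by positivity)] at hle
  have hX : (n * h - n * s * (Real.log 2 / 2) * V ^ 2) * s ≤ L := by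
    have h4 : (4 * L) * 0 ≤ (4 * L) * (L - (n * h - n * s * (Real.log 2 / 2) * V ^ 2) * s) := by
      rw [mul_zero]
      nlinarith [sq_nonneg (n * h * s - 2 * L),
        mul_le_mul_of_nonneg_right h1 (mul_nonneg hn (sq_nonneg s))]
    linarith [le_of_mul_le_mul_left h4 (by linarith : 0 < 4 * L)]
  have hdiv : n * h - n * s * (Real.log 2 / 2) * V ^ 2 ≤ L / s := by rwa [le_div_iff₀ hs]
  linarith [show 0 ≤ n * s ^ 2 * K from by positivity]

/-- At `n = N0v2` DF19's schedule is `s = h/(ln2 V²)` (`h, V, L > 0`).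
Arithmetic on [cite: DupuisFawzi2018, Thm 5.2 proof]. -/
theorem sOpt_at_N0v2 {h V L : ℝ} (hh : 0 < h) (hV : 0 < V) (hL : 0 < L) :
    sOpt (N0v2 h V L) V L = h / (Real.log 2 * V ^ 2) := by
  unfold sOpt N0v2
  have hlog := Real.log_pos one_lt_two
  have harg : 2 * L / (2 * Real.log 2 * V ^ 2 * L / h ^ 2 * Real.log 2)
      = (h / (Real.log 2 * V)) ^ 2 := by
    field_simp
  rw [harg, Real.sqrt_sq (by positivity)]
  field_simp

/-- **The floor is attained.** With `K = 0` the displayed bound VANISHES at `n = N0v2` along the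
schedule, so the constant `2 ln 2` in `N0v2` cannot be lowered for the displayed expression
(the `K_α` term only pushes the zero further out). Arithmetic on
[cite: DupuisFawzi2018, Thm 5.2 eq. (eat-min-alpha)]. -/
theorem renyiBound_eq_zero_at_N0v2 {h V L : ℝ} (hh : 0 < h) (hV : 0 < V) (hL : 0 < L) :
    renyiBound (N0v2 h V L) h V L 0 (sOpt (N0v2 h V L) V L) = 0 := by
  rw [sOpt_at_N0v2 hh hV hL]; unfold renyiBound N0v2
  have hlog := Real.log_pos one_lt_two
  field_simp
  ring

/-- The proof of Thm 5.2, SHARPER FIRST LINE (p16 L20; confidence terms unmerged), `α ∈ (1,2)`: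
`nh − n(α−1)(ln2/2)V² − (α/(α−1))·lρ − n(α−1)²K_α − lε/(α−1)`, `lε = log₂(2/ε²)`,
`lρ = log₂(1/ρ[Ω])`. [cite: DupuisFawzi2018, Thm 5.2 proof] -/
noncomputable def renyiBoundA (n h V lε lρ K α : ℝ) : ℝ :=
  n * h - n * (α - 1) * (Real.log 2 / 2) * V ^ 2 - α / (α - 1) * lρ - n * (α - 1) ^ 2 * K
    - lε / (α - 1)

/-- The sharper first line is the Rényi shape with `L = lε + α·lρ` and `s = α − 1`.
Arithmetic on [cite: DupuisFawzi2018, Thm 5.2 proof]. -/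
theorem renyiBoundA_eq {n h V lε lρ K α : ℝ} (hα : 1 < α) :
    renyiBoundA n h V lε lρ K α = renyiBound n h V (lε + α * lρ) K (α - 1) := by
  unfold renyiBoundA renyiBound; have : α - 1 ≠ 0 := by linarith
  field_simp; ring

/-- DF19's merge of the two confidence terms (p16 L21, uses `α ≤ 2`): the displayed form
(`L = lε + 2 lρ`) is `≤` the first line. Arithmetic on [cite: DupuisFawzi2018, Thm 5.2 proof]. -/
theorem renyiBound_le_renyiBoundA {n h V lε lρ K α : ℝ} (hα1 : 1 < α) (hα2 : α ≤ 2)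
    (hl : 0 ≤ lρ) : renyiBound n h V (lε + 2 * lρ) K (α - 1) ≤ renyiBoundA n h V lε lρ K α := by
  rw [renyiBoundA_eq hα1]; unfold renyiBound
  have : (lε + α * lρ) / (α - 1) ≤ (lε + 2 * lρ) / (α - 1) :=
    div_le_div_of_nonneg_right (by nlinarith) (by linarith)
  linarith

/-- **Floor for the sharper first line**, every `α > 1`, every `K ≥ 0`: `≤ 0` whenever
`n ≤ N0v2 h V (lε + lρ)` (`lε + lρ = log₂(2/(ε² ρ[Ω]))`). Arithmetic on
[cite: DupuisFawzi2018, Thm 5.2 proof]. -/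
theorem renyiBoundA_nonpos {n h V lε lρ K α : ℝ} (hα1 : 1 < α) (hK : 0 ≤ K) (hn : 0 ≤ n)
    (hh : 0 < h) (hlε : 0 < lε) (hlρ : 0 ≤ lρ) (hle : n ≤ N0v2 h V (lε + lρ)) :
    renyiBoundA n h V lε lρ K α ≤ 0 := by
  rw [renyiBoundA_eq hα1]
  refine renyiBound_nonpos_of_le_N0v2 (by linarith) hK hn hh (by nlinarith) (le_trans hle ?_)
  unfold N0v2
  apply div_le_div_of_nonneg_right _ (by positivity)
  exact mul_le_mul_of_nonneg_left (by nlinarith : lε + lρ ≤ lε + α * lρ) (by positivity)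

/-! ## §2 Sufficient rounds at DF19's schedule -/

/-- `sOpt² = 2L/(n ln2 V²)`. Arithmetic on [cite: DupuisFawzi2018, Thm 5.2 proof]. -/
theorem sOpt_sq {n V L : ℝ} (hn : 0 < n) (hV : 0 < V) (hL : 0 ≤ L) :
    sOpt n V L ^ 2 = 2 * L / (n * Real.log 2 * V ^ 2) := by
  unfold sOpt; have := Real.log_pos one_lt_two
  rw [div_pow, Real.sq_sqrt (by positivity)]; field_simp

/-- `sOpt > 0`. Arithmetic on [cite: DupuisFawzi2018, Thm 5.2 proof]. -/
theorem sOpt_pos {n V L : ℝ} (hn : 0 < n) (hV : 0 < V) (hL : 0 < L) : 0 < sOpt n V L := by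
  unfold sOpt; have := Real.log_pos one_lt_two
  exact div_pos (Real.sqrt_pos.mpr (by positivity)) hV

/-- Under `n ≥ 4·N0v2` the schedule satisfies `s·(2 ln2 V²) ≤ h`.
Arithmetic on [cite: DupuisFawzi2018, Thm 5.2 proof]. -/
theorem sOpt_mul_le {n h V L : ℝ} (hn : 0 < n) (hh : 0 < h) (hV : 0 < V) (hL : 0 ≤ L)
    (h1 : 8 * Real.log 2 * V ^ 2 * L / h ^ 2 ≤ n) : sOpt n V L * (2 * Real.log 2 * V ^ 2) ≤ h := by
  have hlog := Real.log_pos one_lt_two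
  have hs0 : 0 ≤ sOpt n V L := by unfold sOpt; positivity
  have hsq : (sOpt n V L * (2 * Real.log 2 * V ^ 2)) ^ 2 ≤ h ^ 2 := by
    rw [mul_pow, sOpt_sq hn hV hL]; rw [div_le_iff₀ (by positivity)] at h1
    have : 2 * L / (n * Real.log 2 * V ^ 2) * (2 * Real.log 2 * V ^ 2) ^ 2
        = 8 * Real.log 2 * V ^ 2 * L / n := by field_simp; ring
    rw [this, div_le_iff₀ hn]
    linarith
  exact (pow_le_pow_iff_left₀ (by positivity) hh.le two_ne_zero).mp hsq

/-- **Sufficient rounds.** At DF19's schedule the displayed bound is `≥ n h/4` as soon as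
`n ≥ 8 ln2 V² L/h² = 4·N0v2` and `n ≥ 8 L K/(ln2 V² h)` (constants sufficient, not sharp).
Arithmetic on [cite: DupuisFawzi2018, Thm 5.2 eq. (eat-min-alpha)]. -/
theorem renyiBound_sOpt_ge {n h V L K : ℝ} (hn : 0 < n) (hh : 0 < h) (hV : 0 < V) (hL : 0 < L)
    (h1 : 8 * Real.log 2 * V ^ 2 * L / h ^ 2 ≤ n)
    (h2 : 8 * L * K / (Real.log 2 * V ^ 2 * h) ≤ n) :
    n * h / 4 ≤ renyiBound n h V L K (sOpt n V L) := by
  have hlog := Real.log_pos one_lt_two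
  have hsle := sOpt_mul_le hn hh hV hL.le h1
  set s := sOpt n V L with hsdef
  have hs : 0 < s := sOpt_pos hn hV hL
  have hs2 : s ^ 2 = 2 * L / (n * Real.log 2 * V ^ 2) := sOpt_sq hn hV hL.le
  have hB : L / s = n * s * (Real.log 2 / 2) * V ^ 2 := by
    rw [div_eq_iff hs.ne']
    have : n * s * (Real.log 2 / 2) * V ^ 2 * s = n * (Real.log 2 / 2) * V ^ 2 * s ^ 2 := by ring
    rw [this, hs2]
    field_simp
  have hA : n * s * (Real.log 2 / 2) * V ^ 2 ≤ n * h / 4 := by nlinarith [hsle, hn]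
  have hC : n * s ^ 2 * K ≤ n * h / 4 := by
    rw [hs2]; rw [div_le_iff₀ (by positivity)] at h2
    have : n * (2 * L / (n * Real.log 2 * V ^ 2)) * K = 2 * L * K / (Real.log 2 * V ^ 2) := by
      field_simp
    rw [this, div_le_iff₀ (by positivity)]
    nlinarith [h2]
  unfold renyiBound
  rw [hB]
  linarith [hA, hC]

/-- The schedule stays inside DF19's α-free `K`-range `α ≤ 1 + 1/(2 ln 2)` (p16 L24) under
`n ≥ 4·N0v2` and `h ≤ V²` (implied by the printed floors `h ≤ log₂ d_A`, `V ≥ √2 + log₂ 3`).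
Arithmetic on [cite: DupuisFawzi2018, Thm 5.2 proof]. -/
theorem sOpt_le_printed {n h V L : ℝ} (hn : 0 < n) (hh : 0 < h) (hV : 0 < V) (hL : 0 ≤ L)
    (h1 : 8 * Real.log 2 * V ^ 2 * L / h ^ 2 ≤ n) (hhV : h ≤ V ^ 2) :
    sOpt n V L ≤ 1 / (2 * Real.log 2) := by
  have hlog := Real.log_pos one_lt_two
  have := sOpt_mul_le hn hh hV hL h1
  rw [le_div_iff₀ (by positivity)]
  nlinarith [pow_pos hV 2]

/-- `K_α` is monotone in `α` on `(−∞, 2)` for `E ≥ 0`, so `Kalpha (1 + 1/(2 ln 2)) E` bounds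
every `K_α` met by the schedule (`sOpt_le_printed`). Arithmetic on
[cite: DupuisFawzi2018, Thm 5.2 eq. (Kalpha)]. -/
theorem Kalpha_mono {α α' E : ℝ} (hαα' : α ≤ α') (h2 : α' < 2) (hE : 0 ≤ E) :
    Kalpha α E ≤ Kalpha α' E := by
  unfold Kalpha
  have hlog := Real.log_pos one_lt_two
  have h2α : 0 < 2 - α := by linarith
  have h2α' : 0 < 2 - α' := by linarith
  have hC : 0 ≤ Real.log ((2 : ℝ) ^ E + Real.exp 2) ^ 3 := pow_nonneg (Real.log_nonneg
    (by linarith [Real.one_le_rpow (show (1:ℝ) ≤ 2 by norm_num) hE, Real.exp_pos 2])) 3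
  have hfac1 : 1 / (6 * (2 - α) ^ 3 * Real.log 2) ≤ 1 / (6 * (2 - α') ^ 3 * Real.log 2) := by
    apply one_div_le_one_div_of_le (by positivity)
    have : (2 - α') ^ 3 ≤ (2 - α) ^ 3 := pow_le_pow_left₀ h2α'.le (by linarith) 3
    nlinarith
  have hfac2 : (2 : ℝ) ^ ((α - 1) * E) ≤ (2 : ℝ) ^ ((α' - 1) * E) :=
    Real.rpow_le_rpow_of_exponent_le (by norm_num) (mul_le_mul_of_nonneg_right (by linarith) hE)
  exact mul_le_mul (mul_le_mul hfac1 hfac2 (by positivity) ((by positivity : _ ≤ _).trans hfac1))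
    le_rfl hC (by positivity)

/-! ## §3 MFSR22 Thm 4.3 (generalised EAT with testing) and the transfer of the floor -/

/-- MFSR22 Thm 4.3 right-hand side (p17): `n h − n ((α−1)/(2−α))(ln2/2)V²
− (g(ε)+α·log₂(1/Pr[Ω]))/(α−1) − n((α−1)/(2−α))² K'(α)` (`gε = g(ε) ≥ 0`,
`lρ = log₂(1/Pr[Ω]) ≥ 0`, `K = K'(α)`). [cite: MetgerEtAl2022, Thm 4.3] -/
noncomputable def geatBound (n h V gε lρ K α : ℝ) : ℝ :=
  n * h - n * ((α - 1) / (2 - α)) * (Real.log 2 / 2) * V ^ 2 - (gε + α * lρ) / (α - 1)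
    - n * ((α - 1) / (2 - α)) ^ 2 * K

/-- The GEAT bound is dominated by the Rényi shape with `s = (α−1)/(2−α)` and
`L = g(ε) + log₂(1/Pr[Ω])` (`1 < α < 2`). Arithmetic on [cite: MetgerEtAl2022, Thm 4.3]. -/
theorem geatBound_le_renyiBound {n h V gε lρ K α : ℝ} (hα1 : 1 < α) (hα2 : α < 2) (hg : 0 ≤ gε)
    (hl : 0 ≤ lρ) :
    geatBound n h V gε lρ K α ≤ renyiBound n h V (gε + lρ) K ((α - 1) / (2 - α)) := by
  unfold geatBound renyiBound
  have hs : α - 1 ≤ (α - 1) / (2 - α) := by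
    rw [le_div_iff₀ (by linarith)]; nlinarith
  have hA := (div_le_div_of_nonneg_left (by positivity : 0 ≤ gε + lρ) (by linarith) hs).trans
    (div_le_div_of_nonneg_right (by nlinarith : gε + lρ ≤ gε + α * lρ) (by linarith : 0 ≤ α - 1))
  linarith

/-- **GEAT floor** on the printed range `α ∈ (1, 3/2)`, every `K'(α) ≥ 0`: the Thm 4.3 bound is
`≤ 0` whenever `n ≤ N0v2 h V (g(ε) + log₂(1/Pr[Ω]))`. Arithmetic on
[cite: MetgerEtAl2022, Thm 4.3] via `geatBound_le_renyiBound`. -/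
theorem geatBound_nonpos_of_le_N0v2 {n h V gε lρ K α : ℝ} (hα1 : 1 < α) (hα2 : α < 3 / 2)
    (hg : 0 ≤ gε) (hl : 0 ≤ lρ) (hL : 0 < gε + lρ) (hK : 0 ≤ K) (hn : 0 ≤ n) (hh : 0 < h)
    (hle : n ≤ N0v2 h V (gε + lρ)) : geatBound n h V gε lρ K α ≤ 0 :=
  le_trans (geatBound_le_renyiBound hα1 (by linarith) hg hl)
    (renyiBound_nonpos_of_le_N0v2 (div_pos (by linarith) (by linarith)) hK hn hh hL hle)

/-! ## §4 Dictionary rows to EAT-v1 (`ProofOfQuantumnessEATRate.mu`) -/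

/-- `ε, ρ[Ω] ∈ (0,1]` ⇒ `L = 1 − 2 log₂(ε ρ[Ω]) ≥ 1`.
Arithmetic on [cite: DupuisFawzi2018, Thm 5.2 eq. (eat-min-alpha)]. -/
theorem one_le_Lval {εs pΩ : ℝ} (hε : 0 < εs) (hε1 : εs ≤ 1) (hp : 0 < pΩ) (hp1 : pΩ ≤ 1) :
    1 ≤ Lval εs pΩ := by
  unfold Lval
  have := Real.logb_nonpos (b := 2) (by norm_num) (mul_pos hε hp).le (by nlinarith : εs * pΩ ≤ 1)
  linarith

/-- `N0v2 = (c/h)²` for DF19 Thm 5.2's headline coefficient `c = √(2 ln2)·V·√L` (`L ≥ 0`).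
Arithmetic on [cite: DupuisFawzi2018, Thm 5.2]. -/
theorem headline_sq_eq_N0v2 {h V L : ℝ} (hL : 0 ≤ L) :
    (Real.sqrt (2 * Real.log 2) * V * Real.sqrt L / h) ^ 2 = N0v2 h V L := by
  unfold N0v2; rw [div_pow, mul_pow, mul_pow, Real.sq_sqrt (by positivity), Real.sq_sqrt hL]

/-- The shared confidence term: EAT-v1's coefficient dominates `2·grad·√L`,
`μ = 2(log₂(1+2d_O) + ⌈grad⌉)·√L ≥ 2·grad·√(Lval ε ρ[Ω])` (`d_O ≥ 0`). Arithmetic on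
[cite: MerkulovArnonFriedman2023, Thm 18 eq. (14)] and [cite: DupuisFawzi2018, Thm 5.2]. -/
theorem two_grad_sqrt_le_mu {dO grad εs pΩ : ℝ} (hdO : 0 ≤ dO) :
    2 * grad * Real.sqrt (Lval εs pΩ) ≤ mu dO grad εs pΩ := by
  unfold mu Lval
  have hlog : 0 ≤ Real.logb 2 (1 + 2 * dO) := Real.logb_nonneg (by norm_num) (by linarith)
  have hceil : grad ≤ (⌈grad⌉ : ℝ) := Int.le_ceil grad
  have hsq : 0 ≤ Real.sqrt (1 - 2 * Real.logb 2 (εs * pΩ)) := Real.sqrt_nonneg _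
  nlinarith [mul_nonneg (show (0:ℝ) ≤ Real.logb 2 (1 + 2 * dO) + (⌈grad⌉ - grad) by linarith) hsq]

end Literature.Computability.QuantumComplexity.RenyiEATRate
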